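import Summits.ValiantsHypothesis.ValiantsHypothesis.Theses.SOSTau
import Literature.Computability.AlgebraicComplexity.TavenasVnWitness
import Literature.Computability.AlgebraicComplexity.SetMultilinear
import Literature.Computability.AlgebraicComplexity.SOSDecompositionProofs
import Literature.Computability.AlgebraicComplexity.ValiantClasses
import Summits.ValiantsHypothesis.ValiantsHypothesis.Theorems.FeketeSOSSOSMagnificationStubPolarisedSOS
import Summits.ValiantsHypothesis.ValiantsHypothesis.Theorems.FeketeSOSSOSMagnificationStubDigitKronecker
import Summits.ValiantsHypothesis.ValiantsHypothesis.Theorems.FeketeSOSSOSMagnificationStubVnpAssembly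
import Summits.ValiantsHypothesis.ValiantsHypothesis.Theorems.SOSTauHutchinsonMagnificationStubHexLiftWitness
import Summits.ValiantsHypothesis.ValiantsHypothesis.Theorems.SOSTauHutchinsonMagnificationStubKroneckerHex
import Summits.ValiantsHypothesis.ValiantsHypothesis.Theorems.SOSTauHutchinsonMagnificationStubHexBudget
import Summits.ValiantsHypothesis.ValiantsHypothesis.Theorems.SOSTauHutchinsonMagnificationStubComplexToReal

/-!
# Crux `SOSTau.HutchinsonMagnification` (stmt-ValiantsHypothesis-18749) — Dutta's magnification for Tavenas' family, PROVED

`theorem HutchinsonMagnification_proof : SOSTau.HutchinsonMagnification`: LINEAR real sparse-SOS hardness of the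
Tavenas–Hutchinson family `V_n = tavenasV n = Σ_{i<2^n} 2^{2i(2^n−1−i)} X^i` — "there are `η > 0`, `n₀` such that for
`n ≥ n₀` every real weighted sum-of-squares representation `Σ_i a_i g_i² = V_n` has support-sum `Σ_i |supp g_i| ≥ η·2^n`" —
implies `VP_ℂ ≠ VNP_ℂ` (= `ValiantsHypothesis`).  This is Dutta 2021, Thm 2 (SOS-τ ⇒ VP ≠ VNP; restated in Bürgisser 2024,
§4.6) specialised to the tree's witness and typed over REAL representations at the linear threshold; the printed chain
(Lemmas 1, 3, 4, 10 of Dutta 2021 = the Dutta–Saxena–Thierauf magnification) is formalised as the composition of the four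
landed stubs of line `SketchWitness` (`Cruxes/HutchinsonMagnification/Lines/SketchWitness.lean`):

* W  `stub_hexLiftWitness` — Bürgisser Def. 2.5 witness for the hex digit lift `P_m` of `V_{4m}` (transcript polynomial of
     Tavenas' exponent circuit `vCirc (4m)`), whence `(P_m)_m ∈ VNP_ℂ` by the landed level-wise assembly
     `isVNPFamily_of_levelwise'` (`vnpHexLift` below; Dutta Lemma 3 — constants are free);
* T2 `stub_kroneckerHex` — `P_m` is set-multilinear of degree `m` and the inverse Kronecker map `y_{(j,h)} ↦ X^{h 16^j}` sends
     it to `V_{4m}` (Dutta Lemma 4, the map `ψ`);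
* T3 `stub_hexBudget` — `2^{m+1}·(m+1)(16 L²(m+1)⁴)^{⌊log₂ m⌋}·(16^{⌊m/2⌋} + 16^{⌈m/2⌉}) < η·16^m` eventually (quasi-poly · 8^m);
* R  `stub_complexToReal` — a complex representation of a real polynomial realifies with support ×4 (Dutta Lemma 10);

glued by the tree's VSBR middle cut `exists_bilin_of_two_le_totalDegree` (Dutta Lemma 1; DST 2024 Lemma 3.1), the landed
polarised set-multilinear projection `stub_polarisedSOS` (radix 16) and the landed Kronecker transport `dk_partA`.
`collapseCheapComplexSOS` is, by name, the route's support item stmt-ValiantsHypothesis-18751 (`VP_ℂ = VNP_ℂ ⇒` cheap complex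
SOS representations of `V_{4m}` infinitely often).

References: P. Dutta, *Real τ-conjecture for sum-of-squares: a unified approach to lower bound and derandomization*, CSR 2021
(LNCS 12730), Thm 2 with Lemmas 1, 3, 4, 10; P. Dutta, N. Saxena, T. Thierauf, ITCS 2021, Thm 6, and JCSS 2024, Lemma 3.1;
P. Bürgisser, *Completeness and Reduction in Algebraic Complexity Theory* (2000), Def. 2.5; S. Tavenas, thèse (2014), §3.
-/

set_option linter.dupNamespace false

noncomputable section

open MvPolynomial Finset
open Literature.Computability.AlgebraicComplexity
open Summit.ValiantsHypothesis.ValiantsHypothesis.Theorems.FeketeSOSSOSMagnification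
  (stub_polarisedSOS dk_partA isVNPFamily_of_levelwise')

namespace Summit.ValiantsHypothesis.ValiantsHypothesis.Theorems.SOSTauHutchinsonMagnification

/-! ## The hex digit lift family of `V_{4m}` is in `VNP_ℂ` (Bürgisser Def. 2.5, from stub W) -/

/-- The hex digit lift is a p-family: `16 m` variables, degree `≤ m`. -/
theorem isPFamily_hexLift :
    @IsPFamily ℂ _ (fun m => Fin m × Fin 16) _
      (fun m => ∑ i ∈ Finset.range (16 ^ m), C ((2 : ℂ) ^ vExp (4 * m) i) *
        ∏ j : Fin m, X (j, (⟨i / 16 ^ (j : ℕ) % 16, Nat.mod_lt _ (by norm_num)⟩ : Fin 16))) := by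
  refine ⟨?_, IsPBounded.mono IsPBounded.id fun m => ?_⟩
  · refine IsPBounded.mono (IsPBounded.mul_holds (IsPBounded.const 16) IsPBounded.id) fun m => ?_
    simp [mul_comm]
  · refine totalDegree_finsetSum_le fun i _ => ?_
    refine (totalDegree_mul _ _).trans ?_
    rw [totalDegree_C, zero_add]
    refine (totalDegree_finsetProd _ _).trans ?_
    calc ∑ j : Fin m, (X (j, (⟨i / 16 ^ (j : ℕ) % 16, Nat.mod_lt _ (by norm_num)⟩ : Fin 16)) :
            MvPolynomial (Fin m × Fin 16) ℂ).totalDegree ≤ ∑ _j : Fin m, 1 :=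
          Finset.sum_le_sum fun j _ => CircuitArith.totalDegree_X_le_one' (k := ℂ) _
      _ = m := by simp

/-- Tavenas' exponent circuit is polynomial-size in the level, hence so is the cost bound `β`. -/
theorem isPBounded_hexBound : IsPBounded fun m : ℕ => 60 * TavenasVn.vExpSize (4 * m) + 300 * (m + 1) := by
  have c := fun k : ℕ => IsPBounded.const k
  have h4 : IsPBounded (fun m : ℕ => 4 * m) := IsPBounded.mul_holds (c 4) IsPBounded.id
  have hstep : IsPBounded (fun m : ℕ => Literature.Computability.Complexity.ArithCkt.mulStepSize (4 * m)) := by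
    unfold Literature.Computability.Complexity.ArithCkt.mulStepSize
      Literature.Computability.Complexity.ArithCkt.addSize
    exact IsPBounded.add_holds (IsPBounded.add_holds h4 h4)
      (IsPBounded.add_holds (IsPBounded.mul_holds (c 73) (IsPBounded.add_holds h4 h4)) (c 1))
  have hsz : IsPBounded fun m : ℕ => TavenasVn.vExpSize (4 * m) := by
    unfold TavenasVn.vExpSize
    exact IsPBounded.add_holds (IsPBounded.add_holds h4
      (IsPBounded.add_holds (IsPBounded.mul_holds h4 hstep) (c 1))) (c 1)
  exact IsPBounded.add_holds (IsPBounded.mul_holds (c 60) hsz)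
    (IsPBounded.mul_holds (c 300) (IsPBounded.add_holds IsPBounded.id (c 1)))

/-- **The hex digit lift family of `V_{4m}` is a `VNP` family over `ℂ`** (stub W + the landed level-wise Def. 2.5
assembly `isVNPFamily_of_levelwise'`; Dutta 2021 Lemma 3 for Tavenas' family, constants free). -/
theorem vnpHexLift :
    @IsVNPFamily ℂ _ (fun m => Fin m × Fin 16) _
      (fun m => ∑ i ∈ Finset.range (16 ^ m), C ((2 : ℂ) ^ vExp (4 * m) i) *
        ∏ j : Fin m, X (j, (⟨i / 16 ^ (j : ℕ) % 16, Nat.mod_lt _ (by norm_num)⟩ : Fin 16))) :=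
  isVNPFamily_of_levelwise' isPFamily_hexLift isPBounded_hexBound stub_hexLiftWitness

/-! ## `VP_ℂ = VNP_ℂ` ⇒ cheap complex SOS representations of `V_{4m}` (support item `CollapseCheapComplexSOS` BY NAME) -/

/-- **Support item stmt-ValiantsHypothesis-18751 `SOSTau.CollapseCheapComplexSOS` (PROVED).** `VP_ℂ = VNP_ℂ ⇒` for every
`η > 0`, at every level `n = 4m` with `m` large, `V_n` has a complex weighted SOS representation of support-sum `< η·2^n`:
VNP-membership of the hex lift (`vnpHexLift`), hence `VP` under the collapse; VSBR middle cut at `m/2`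
(`exists_bilin_of_two_le_totalDegree`); polarised set-multilinear projection (`stub_polarisedSOS`, radix 16); inverse
Kronecker substitution (`stub_kroneckerHex`, `dk_partA`); budget (`stub_hexBudget`). -/
theorem collapseCheapComplexSOS :
    Summit.ValiantsHypothesis.ValiantsHypothesis.Theses.SOSTau.CollapseCheapComplexSOS := by
  classical
  intro hEq η hη n₀
  -- (1) the hex lift family is in VNP (transcript witness), hence in VP under the collapse: an exponent `c`
  have h1 := vnpHexLift
  have hVP : @IsVPFamily ℂ _ (fun m => Fin m × Fin 16) _
      (fun m => ∑ i ∈ Finset.range (16 ^ m), C ((2 : ℂ) ^ vExp (4 * m) i) *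
        ∏ j : Fin m, X (j, (⟨i / 16 ^ (j : ℕ) % 16, Nat.mod_lt _ (by norm_num)⟩ : Fin 16))) := by
    have hmem := (mem_VNP_ofFintype_iff_holds (k := ℂ) (σ := fun m => Fin m × Fin 16) _).2 h1
    rw [← hEq] at hmem
    exact (mem_VP_ofFintype_iff_holds (k := ℂ) (σ := fun m => Fin m × Fin 16) _).1 hmem
  obtain ⟨c, hc⟩ := hVP.2
  -- (2) the budget threshold and a large level `m`
  obtain ⟨m₀, hm₀⟩ := stub_hexBudget c η hη
  obtain ⟨m, hm₀m, hn₀m, h2m⟩ : ∃ m, m₀ ≤ m ∧ n₀ ≤ m ∧ 2 ≤ m :=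
    ⟨max (max m₀ n₀) 2, le_trans (le_max_left _ _) (le_max_left _ _),
      le_trans (le_max_right _ _) (le_max_left _ _), le_max_right _ _⟩
  refine ⟨4 * m, by omega, ?_⟩
  -- the level-`m` lift `P` and the inverse Kronecker substitution `κ`
  set P : MvPolynomial (Fin m × Fin 16) ℂ :=
    ∑ i ∈ Finset.range (16 ^ m), C ((2 : ℂ) ^ vExp (4 * m) i) *
      ∏ j : Fin m, X (j, (⟨i / 16 ^ (j : ℕ) % 16, Nat.mod_lt _ (by norm_num)⟩ : Fin 16)) with hPdef
  set κ : Fin m × Fin 16 → Polynomial ℂ :=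
    fun v => (Polynomial.X : Polynomial ℂ) ^ ((v.2 : ℕ) * 16 ^ (v.1 : ℕ)) with hκdef
  have hcm : complexity P ≤ m ^ c + c := hc m
  have hB := hm₀ m hm₀m (complexity P) hcm
  -- (3) lift facts (T2): set-multilinear, total degree `m`, `κ P = V_{4m}`
  obtain ⟨hsml, hdeg, hfaith⟩ := stub_kroneckerHex m
  -- (4) the bilinear middle cut at `j = m / 2` (tree: DST24 Lemma 3.1, steps 1–4)
  have h2deg : 2 ≤ P.totalDegree := by rw [hdeg]; exact h2m
  obtain ⟨-, Lst, hLlen, hLdeg, hLsum⟩ := exists_bilin_of_two_le_totalDegree P h2deg (m / 2)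
  rw [hdeg] at hLlen hLdeg
  set t := Lst.length with ht
  have hPsum : P = ∑ i : Fin t, (Lst[(i : ℕ)]).1 * (Lst[(i : ℕ)]).2 := by
    rw [Fin.sum_univ_fun_getElem Lst fun gh => gh.1 * gh.2]
    exact hLsum.symm
  have hgdeg : ∀ i : Fin t, (Lst[(i : ℕ)]).1.totalDegree ≤ m / 2 := fun i =>
    (hLdeg _ (List.getElem_mem i.2)).1
  have hhdeg : ∀ i : Fin t, (Lst[(i : ℕ)]).2.totalDegree ≤ m - m / 2 := fun i =>
    (hLdeg _ (List.getElem_mem i.2)).2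
  -- (5) set-multilinear projection + polarisation (tree: `stub_polarisedSOS`, radix 16)
  obtain ⟨s, a, q, hs, hrep, hsupp, hbsm⟩ :=
    stub_polarisedSOS m 16 t (m / 2) (m - m / 2) P
      (fun i => (Lst[(i : ℕ)]).1) (fun i => (Lst[(i : ℕ)]).2) (by norm_num) hsml hPsum hgdeg hhdeg
  -- (6) Kronecker transport of the identity and of the supports (tree: `dk_partA`)
  have hGrep : (∑ i, Polynomial.C (a i) * (MvPolynomial.aeval κ (q i)) ^ 2) =
      (tavenasV (4 * m)).map (Int.castRingHom ℂ) := by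
    have h := congrArg (MvPolynomial.aeval κ) hrep
    rw [hfaith, map_sum] at h
    simp only [map_mul, map_pow, MvPolynomial.aeval_C, Polynomial.algebraMap_eq] at h
    exact h.symm
  have hGsupp : ∀ i, (MvPolynomial.aeval κ (q i)).support.card ≤ 16 ^ (m / 2) + 16 ^ (m - m / 2) :=
    fun i => ((dk_partA m 16 (q i) (hbsm i)).1).trans (hsupp i)
  refine ⟨s, a, fun i => MvPolynomial.aeval κ (q i), hGrep, ?_⟩
  -- (7) the support-sum count against the budget
  have hsT : s ≤ 2 ^ (m + 1) * ((m + 1) * ((4 * complexity P * (m + 1) ^ 2) *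
      (4 * complexity P * (m + 1) ^ 2)) ^ Nat.log 2 m) :=
    hs.trans (Nat.mul_le_mul_left _ hLlen)
  have hsum : (∑ i, ((MvPolynomial.aeval κ (q i)).support.card : ℝ)) ≤
      ((2 ^ (m + 1) * ((m + 1) * ((4 * complexity P * (m + 1) ^ 2) *
        (4 * complexity P * (m + 1) ^ 2)) ^ Nat.log 2 m) *
        (16 ^ (m / 2) + 16 ^ (m - m / 2)) : ℕ) : ℝ) := by
    calc (∑ i, ((MvPolynomial.aeval κ (q i)).support.card : ℝ))
        ≤ ∑ _i : Fin s, ((16 ^ (m / 2) + 16 ^ (m - m / 2) : ℕ) : ℝ) :=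
          Finset.sum_le_sum fun i _ => by exact_mod_cast hGsupp i
      _ = (s : ℝ) * ((16 ^ (m / 2) + 16 ^ (m - m / 2) : ℕ) : ℝ) := by
          rw [Finset.sum_const, Finset.card_univ, Fintype.card_fin, nsmul_eq_mul]
      _ ≤ _ := by exact_mod_cast Nat.mul_le_mul_right _ hsT
  exact lt_of_le_of_lt hsum hB

/-! ## The crux -/

/-- **THE CRUX `SOSTau.HutchinsonMagnification` (stmt-ValiantsHypothesis-18749), PROVED** — Dutta 2021 Thm 2 for Tavenas'
family at the linear threshold: assume linear real sparse-SOS hardness of `V_n` with data `(η, n₀)` and, for contradiction,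
`VP_ℂ = VNP_ℂ`; `collapseCheapComplexSOS` at `η/4` yields a level `n = 4m ≥ n₀` and a complex representation of `V_n` of
support-sum `< (η/4)·2^n`; realify it (`stub_complexToReal`, support ×4, `((V_n)_ℝ)_ℂ = (V_n)_ℂ` by `Polynomial.map_map`)
and feed it to the hardness hypothesis: `η·2^n ≤ 4·(< (η/4)·2^n)`, absurd. -/
theorem HutchinsonMagnification_proof :
    Summit.ValiantsHypothesis.ValiantsHypothesis.Theses.SOSTau.HutchinsonMagnification := by
  classical
  have hCol := collapseCheapComplexSOS
  have hCR := stub_complexToReal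
  rintro ⟨η, hη, n₀, H⟩
  show Literature.Computability.AlgebraicComplexity.VP ℂ ≠
    Literature.Computability.AlgebraicComplexity.VNP ℂ
  intro hEq
  obtain ⟨n, hn, s, a, g, hrep, hlt⟩ := hCol hEq (η / 4) (by positivity) n₀
  have hrep' : (∑ i, Polynomial.C (a i) * g i ^ 2) =
      ((tavenasV n).map (Int.castRingHom ℝ)).map (algebraMap ℝ ℂ) := by
    rw [hrep, Polynomial.map_map]
    congr 1
  obtain ⟨s', a', g', hreal, hle⟩ := hCR ((tavenasV n).map (Int.castRingHom ℝ)) s a g hrep'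
  have key := H n hn s' a' g' hreal
  have hcast : (∑ i, ((g' i).support.card : ℝ)) ≤ 4 * ∑ i, ((g i).support.card : ℝ) := by
    have := (Nat.cast_le (α := ℝ)).mpr hle
    push_cast at this
    exact this
  have h2 : (0 : ℝ) < 2 ^ n := by positivity
  linarith

end Summit.ValiantsHypothesis.ValiantsHypothesis.Theorems.SOSTauHutchinsonMagnification

end
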